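import Literature.AnabelianGeometry.EtaleTheta.GalSectKxHatTorsion
import Literature.NumberTheory.GaloisRepresentations.LocalUnitsProfiniteCompletion
import HarnessLib

/-!
# `K^× ⊆ (K^×)^∧`: the canonical map `toKxHat` is injective for the base field of a tempered curve (proof-only)

Mochizuki, *Galois sections in absolute anabelian geometry* [GalSect], §4 p. 33 / p. 41 («`K^× ⊆ (K^×)^∧`», the profinite
completion of `K^×`) [cite: MochizukiGalSect2005, §4 p.33]; [EtTh] Thm. 1.10 (iii) p. 256 [cite: MochizukiEtTh2009, Thm 1.10 (iii) p.30].
abc-iut cell, layer L2, seat abc-iut-w5-d062 (gen 4).  Companion of `GalSectKxHatTorsion` (p450815).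

The interface file `GalSectCuspidalTorsors` records `toKxHat : K^× → (K^×)^∧` with the remark «injective — `K^× ≅ ℤ × O_K^×` is
residually finite … not needed below, not proved here».  It IS needed by the (μtor)/(gen) census of [EtTh] Thm. 1.10 (iii)
(`μ₂(K) ⊆ (K^×)^∧` has exactly two elements; abc-iut-w5-d029's C7e clause (2) census «`toKxHat (−1) ≠ 1`»), and it is a
THEOREM of the tree: the L4 / GaloisRepresentations lane's `eta_units_injective` (Neukirch, *ANT* II (5.7): `K^× ↪ Ẑ × O_K^×`)
for the non-archimedean local field structure of a finite extension of `ℚ_p` (`Padic.isNonarchimedeanLocalField_holds`,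
`FiniteExtension.isNonarchimedeanLocalField`; the conclusion is topology-free, so it is stated for an ABSTRACT finite
extension first and then specialised to `K = X.K ⊆ ℚ̄_p`).

* `GalSect.eta_units_injective_padic` — `η : Kˣ → (Kˣ)^∧` injective for ANY finite extension `K/ℚ_p`;
* `GalSect.toKxHat_injective`, `toKxHat_eq_one_iff`, `neg_one_ne_one_unitsK`, `toKxHat_neg_one_ne_one`;
* `MuTwoSetting.toKxHat_neg_one_mem_muTwoHat`, `MuTwoSetting.exists_mem_muTwoHat_ne_one`, `MuTwoSetting.muTwoHat_ne_bot`,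
  `MuTwoSetting.mem_muTwoHat_iff_eq_one_or` — `μ₂(K) = {1, η(−1)} ⊆ (K^×)^∧` with `η(−1) ≠ 1`.

Theorems only (no definitions, no named facts, no `sorry`).  HONEST FRAMING: classical (local fields); nothing here takes a
side on [IUTchIII] Cor. 3.12; typed ≠ proved for the node's remaining inputs.
-/

noncomputable section

namespace Literature.AnabelianGeometry.EtaleTheta

open Literature.AnabelianGeometry.SemiGraphs
open Literature.NumberTheory.GaloisRepresentations
open ProfiniteGrp ProfiniteGrp.ProfiniteCompletion

universe u

variable {p : ℕ} [Fact p.Prime]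

namespace GalSect

/-- **`η : Kˣ → (Kˣ)^∧` is injective for every finite extension `K` of `ℚ_p`** (`K^×` is residually finite; Neukirch,
*ANT* II (5.7)) — the GaloisRepresentations lane's `eta_units_injective` at the local-field structure of `K ⊇ ℚ_p`; stated
for an abstract `K` (topology-free conclusion). [cite: NeukirchANT1999, Ch. II Prop. (5.7)] -/
theorem eta_units_injective_padic (K : Type u) [Field K] [Algebra ℚ_[p] K] [FiniteDimensional ℚ_[p] K] :
    Function.Injective (eta (GrpCat.of Kˣ)).hom := by
  haveI : IsNonarchimedeanLocalField ℚ_[p] := Padic.isNonarchimedeanLocalField_holds p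
  letI := FiniteExtension.valuativeRel ℚ_[p] K
  letI := FiniteExtension.topologicalSpace ℚ_[p] K
  haveI : IsNonarchimedeanLocalField K := FiniteExtension.isNonarchimedeanLocalField ℚ_[p] K
  haveI : CharZero K := charZero_of_injective_algebraMap (algebraMap ℚ_[p] K).injective
  exact eta_units_injective K

/-- **«`K^× ⊆ (K^×)^∧`»** ([GalSect] §4 p. 41): `toKxHat : K^× → (K^×)^∧` is injective for the base field of every
tempered curve. [cite: MochizukiGalSect2005, §4 p.33] -/
theorem toKxHat_injective (X : TemperedCurve p) : Function.Injective (toKxHat X) := by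
  haveI : FiniteDimensional ℚ_[p] ↥X.K := X.finiteDimensional_K
  exact eta_units_injective_padic (p := p) ↥X.K

/-- `toKxHat u = 1 ↔ u = 1`. [cite: MochizukiGalSect2005, §4 p.33] -/
theorem toKxHat_eq_one_iff (X : TemperedCurve p) {u : (↥X.K)ˣ} : toKxHat X u = 1 ↔ u = 1 := by
  rw [← map_one (toKxHat X)]
  exact (toKxHat_injective X).eq_iff

/-- `−1 ≠ 1` in `K^×` (`K ⊇ ℚ_p` has characteristic `0`). [cite: MochizukiGalSect2005, §4 p.33] -/
theorem neg_one_ne_one_unitsK (X : TemperedCurve p) : (-1 : (↥X.K)ˣ) ≠ 1 := by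
  haveI : CharZero ↥X.K := charZero_of_injective_algebraMap (algebraMap ℚ_[p] ↥X.K).injective
  intro h
  have h' : ((-1 : (↥X.K)ˣ) : ↥X.K) = ((1 : (↥X.K)ˣ) : ↥X.K) := congrArg Units.val h
  rw [Units.val_neg, Units.val_one] at h'
  have h2 : (2 : ↥X.K) = 0 := by
    rw [← one_add_one_eq_two]
    nth_rewrite 1 [← h']
    exact neg_add_cancel 1
  exact two_ne_zero h2

/-- **`η(−1) ≠ 1` in `(K^×)^∧`** — the non-trivial element of `μ₂(K) ⊆ (K^×)^∧` (abc-iut-w5-d029's C7e clause (2) census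
input, here for EVERY tempered curve). [cite: MochizukiGalSect2005, §4 p.33] -/
theorem toKxHat_neg_one_ne_one (X : TemperedCurve p) : toKxHat X (-1) ≠ 1 := fun h =>
  neg_one_ne_one_unitsK X ((toKxHat_eq_one_iff X).mp h)

end GalSect

namespace MuTwoSetting

/-- `η(−1) ∈ μ₂(K)`. [cite: MochizukiEtTh2009, Thm 1.10 (iii) p.30] -/
theorem toKxHat_neg_one_mem_muTwoHat (M : MuTwoSetting p) :
    GalSect.toKxHat M.toThetaSetting.toTemperedCurve (-1) ∈ M.muTwoHat :=
  ⟨-1, neg_one_sq, rfl⟩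

/-- **`μ₂(K) ⊆ (K^×)^∧` is non-trivial**: it contains `η(−1) ≠ 1`. [cite: MochizukiEtTh2009, Thm 1.10 (iii) p.30] -/
theorem exists_mem_muTwoHat_ne_one (M : MuTwoSetting p) :
    ∃ x ∈ M.muTwoHat, x ≠ 1 :=
  ⟨_, M.toKxHat_neg_one_mem_muTwoHat, GalSect.toKxHat_neg_one_ne_one _⟩

/-- `μ₂(K) ≠ 1` in `(K^×)^∧`. [cite: MochizukiEtTh2009, Thm 1.10 (iii) p.30] -/
theorem muTwoHat_ne_bot (M : MuTwoSetting p) : M.muTwoHat ≠ ⊥ := by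
  intro h
  obtain ⟨x, hx, hne⟩ := M.exists_mem_muTwoHat_ne_one
  rw [h] at hx
  exact hne (Subgroup.mem_bot.mp hx)

/-- **`μ₂(K) = {1, η(−1)}`** read in `(K^×)^∧`: membership in `muTwoHat` is `x = 1 ∨ x = η(−1)` (with `η(−1) ≠ 1`,
`toKxHat_neg_one_ne_one`, the two are distinct). [cite: MochizukiEtTh2009, Thm 1.10 (iii) p.30] -/
theorem mem_muTwoHat_iff_eq_one_or (M : MuTwoSetting p) (x : GalSect.KxHat M.toThetaSetting.toTemperedCurve) :
    x ∈ M.muTwoHat ↔ x = 1 ∨ x = GalSect.toKxHat M.toThetaSetting.toTemperedCurve (-1) := by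
  constructor
  · intro hx
    exact M.eq_one_or_eq_toKxHat_neg_one_of_mul_self_eq_one x (M.muTwoHat_le_twoTorsion hx)
  · rintro (rfl | rfl)
    · exact M.muTwoHat.one_mem
    · exact M.toKxHat_neg_one_mem_muTwoHat

end MuTwoSetting

end Literature.AnabelianGeometry.EtaleTheta

end
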